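import Summits.BirchSwinnertonDyer.BirchSwinnertonDyer.Theorems.AlignedTransportAtTwoMainConjectureTransportAlignedAtTwoBothAddBirch
import HarnessLib

/-!
# Route `AlignedTransportAtTwo`, crux C1 (stmt-BirchSwinnertonDyer-22296), line `birth` — the WILD both-additive twist leg, part A (BIRCH):
# `N_E ∣ N_{E^{(d)}}`, `d² ∣ N_{E^{(d)}}`, `f_A = (f_W)_χ`, Birch's lemma with the period identity and the transform identity, when `E^{(d)}` is
# ADDITIVE at every prime of `d` and `ord_ℓ N_E ≤ ord_ℓ N_{E^{(d)}}` there — NO `ℓ ≥ 5`, so the prime `3` (wild ramification) is allowed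

HONEST FRAMING (cell `bsd-f1-sign2`, WIDTH-5 attach seat `bsd-line-att-p4` g10 under lead `bsd-line-att-p1`). BSD is NOT proved; C1 is NOT closed.
THEOREMS ONLY; nothing asserted; `--supports stmt-BirchSwinnertonDyer-22296 --as helper`.

The lead's part 4 (`…BothAddBirch`) re-runs the tree's Birch files under `hadd : ∀ v ∣ d, 5 ≤ ℓ_v ∧ E^{(d)} additive at v`; the bound `5 ≤ ℓ_v` is used
at exactly one point — `f_ℓ(E) ≤ 2 ≤ f_ℓ(E^{(d)})` (`conductorExponent_le_two_of_five_le_natGenerator_holds`), i.e. `ord_ℓ N_E ≤ ord_ℓ N_{E^{(d)}}`,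
which makes `(f_W)_χ` a form of level `N_A`. This file replaces `5 ≤ ℓ_v` by that inequality ITSELF
(`hadd : ∀ v ∣ d, ord_{ℓ_v} N_W ≤ ord_{ℓ_v} N_A ∧ A additive at v`), a strictly weaker hypothesis, so that a prime `ℓ = 3` of `d` at which both
curves are additive (possibly WILD, `f_3 ∈ {2,…,5}`) is admitted as soon as `f_3(W) ≤ f_3(A)`. (When both curves are additive at `3` one has in fact
`f_3(W) = f_3(A)` — the Swan conductor is invariant under the tame twist — but that is not in the tree; the both-additive walk of part D peels the
prime `3` from the side with the smaller exponent instead, using the symmetry of the `λ`-line law under analytic `μ = 0`.) Everything else is the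
lead's part 4 verbatim (its §1 `LFunction_quadraticTwist_apply_of_addv` and `hasAdditiveReductionAt_quadraticTwist_of_model` are imported).

References: [MazurTateTeitelbaum1986Invent] §I.8, §I.11; [Shimura1971] Prop. 3.64; [AtkinLehner1970] §6; [SilvermanAEC2009] App. C §16, VII.5;
[SilvermanATAEC1994] IV.10.2; [Matsuno2000] §2–§3 (additive primes, `ε(ℓ) = 0`).
-/

set_option autoImplicit false
set_option linter.dupNamespace false

noncomputable section

open scoped Classical MatrixGroups ModularForm NumberTheorySymbols

open Filter CongruenceSubgroup NumberField IsDedekindDomain IsDedekindDomain.HeightOneSpectrum Rat.HeightOneSpectrum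
  WeierstrassCurve PowerSeries Literature.NumberTheory.EllipticCurves Literature.NumberTheory.EllipticCurves.ModularForms
  Literature.NumberTheory.EllipticCurves.GreenbergVatsal2000
open Summit.BirchSwinnertonDyer.BirchSwinnertonDyer.Theorems.AlignedTransportAtTwoBothAddCongruence
open Summit.BirchSwinnertonDyer.BirchSwinnertonDyer.Theorems.AlignedTransportAtTwoBothAddBirch

namespace Summit.BirchSwinnertonDyer.BirchSwinnertonDyer.Theorems.AlignedTransportAtTwoWildTwistBirch

variable (W : WeierstrassCurve ℚ) [W.IsElliptic]

/-! ## §1 `N_E ∣ N_{E^{(d)}}`, `d² ∣ N_{E^{(d)}}` when `E^{(d)}` is additive at the primes of `d` and `ord_ℓ N_E ≤ ord_ℓ N_{E^{(d)}}` there -/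

/-- **`N_E ∣ N_{E^{(d)}}`, `d² ∣ N_{E^{(d)}}`, `2 ∤ N_E ⇒ 2 ∤ N_{E^{(d)}}`** when at every place `v` over `d` the twist `E^{(d)}` is additive and
`ord_{ℓ_v} N_E ≤ ord_{ℓ_v} N_{E^{(d)}}` (`f_v(E^{(d)}) ≥ 2` by additivity; off `d` the exponents agree). The lead's `…_of_addv` is the case
`ℓ_v ≥ 5` (`f_v(E) ≤ 2`); here `ℓ_v = 3` is allowed. [cite: SilvermanAEC2009, App. C §16 (PDF pp. 390–391)] [cite: SilvermanATAEC1994, Thm. IV.10.2] -/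
theorem conductorNorm_dvd_and_sq_dvd_conductorNorm_quadraticTwist_of_addv_le {d : ℤ} (hd4 : d % 4 = 1) (hsq : Squarefree d)
    (hadd : ∀ v : HeightOneSpectrum ℤ, ((natGenerator v : ℕ) : ℤ) ∣ d →
      (haveI := W.isElliptic_quadraticTwist (show ((d : ℚ)) ≠ 0 by exact_mod_cast (show d ≠ 0 by omega));
        (W.conductorNorm ℤ).factorization (natGenerator v) ≤
            ((W.quadraticTwist (d : ℚ)).conductorNorm ℤ).factorization (natGenerator v) ∧
          (W.quadraticTwist (d : ℚ)).HasAdditiveReductionAt v)) :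
    (haveI := W.isElliptic_quadraticTwist (show ((d : ℚ)) ≠ 0 by exact_mod_cast (show d ≠ 0 by omega));
      W.conductorNorm ℤ ∣ (W.quadraticTwist (d : ℚ)).conductorNorm ℤ ∧
        d.natAbs ^ 2 ∣ (W.quadraticTwist (d : ℚ)).conductorNorm ℤ ∧
        (¬ 2 ∣ W.conductorNorm ℤ → ¬ 2 ∣ (W.quadraticTwist (d : ℚ)).conductorNorm ℤ)) := by
  have hd0 : d ≠ 0 := by omega
  have hdq : (d : ℚ) ≠ 0 := by exact_mod_cast hd0
  haveI := W.isElliptic_quadraticTwist hdq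
  set N := W.conductorNorm ℤ with hN
  set N' := (W.quadraticTwist (d : ℚ)).conductorNorm ℤ with hN'
  have hN0 : N ≠ 0 := (W.conductorNorm_pos_holds).ne'
  have hN'0 : N' ≠ 0 := ((W.quadraticTwist (d : ℚ)).conductorNorm_pos_holds).ne'
  have hgen : ∀ q : Nat.Primes, natGenerator ((primesEquiv (R := ℤ)).symm q) = q := fun q ↦
    congrArg (fun q : Nat.Primes ↦ (q : ℕ)) ((primesEquiv (R := ℤ)).apply_symm_apply q)
  have hle : ∀ q : ℕ, q.Prime → N.factorization q ≤ N'.factorization q ∧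
      (((q : ℤ) ∣ d) → 2 ≤ N'.factorization q) := by
    intro q hq
    set vq : HeightOneSpectrum ℤ := (primesEquiv (R := ℤ)).symm ⟨q, hq⟩ with hvq
    have hgenq : natGenerator vq = q := by rw [hvq]; exact hgen ⟨q, hq⟩
    by_cases hqd : (q : ℤ) ∣ d
    · obtain ⟨hle, haddv⟩ := hadd vq (by rw [hgenq]; exact hqd)
      rw [hgenq] at hle
      have hfA : N'.factorization q = (W.quadraticTwist (d : ℚ)).conductorExponent vq := by
        rw [← hgenq]; exact factorization_conductorNorm_holds _ vq
      have h2 : 2 ≤ (W.quadraticTwist (d : ℚ)).conductorExponent vq :=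
        (two_le_conductorExponent_iff_holds vq (W.quadraticTwist (d : ℚ))).mpr haddv
      exact ⟨hle, fun _ ↦ by rw [hfA]; exact h2⟩
    · have h := W.factorization_conductorNorm_quadraticTwist_eq_of_not_dvd hd4 vq (by rw [hgenq]; exact hqd)
      rw [hgenq] at h
      exact ⟨h.symm.le, fun h' ↦ absurd h' hqd⟩
  refine ⟨?_, ?_, ?_⟩
  · refine (Nat.factorization_le_iff_dvd hN0 hN'0).mp (Finsupp.le_def.mpr fun q ↦ ?_)
    by_cases hq : q.Prime
    · exact (hle q hq).1
    · rw [Nat.factorization_eq_zero_of_not_prime _ hq]; exact Nat.zero_le _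
  · have hda : d.natAbs ≠ 0 := Int.natAbs_ne_zero.mpr hd0
    refine (Nat.factorization_le_iff_dvd (pow_ne_zero 2 hda) hN'0).mp (Finsupp.le_def.mpr fun q ↦ ?_)
    rw [Nat.factorization_pow, Finsupp.smul_apply, smul_eq_mul]
    by_cases hq : q.Prime
    · by_cases hqd : (q : ℤ) ∣ d
      · have hsq1 : d.natAbs.factorization q ≤ 1 :=
          Nat.squarefree_iff_factorization_le_one hda |>.mp (Int.squarefree_natAbs.mpr hsq) q
        calc 2 * d.natAbs.factorization q ≤ 2 * 1 := by gcongr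
          _ ≤ N'.factorization q := by rw [mul_one]; exact (hle q hq).2 hqd
      · have h0 : d.natAbs.factorization q = 0 :=
          Nat.factorization_eq_zero_of_not_dvd fun h ↦ hqd (Int.natCast_dvd.mpr h)
        rw [h0, mul_zero]; exact Nat.zero_le _
    · rw [Nat.factorization_eq_zero_of_not_prime _ hq, mul_zero]; exact Nat.zero_le _
  · intro h2N h2N'
    have h2d : ¬ ((2 : ℕ) : ℤ) ∣ d := by intro h; omega
    set v2 : HeightOneSpectrum ℤ := (primesEquiv (R := ℤ)).symm ⟨2, Nat.prime_two⟩ with hv2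
    have hgen2 : natGenerator v2 = 2 := by rw [hv2]; exact hgen ⟨2, Nat.prime_two⟩
    have h := W.factorization_conductorNorm_quadraticTwist_eq_of_not_dvd hd4 v2 (by rw [hgen2]; exact h2d)
    rw [hgen2] at h
    have hpos : 0 < N'.factorization 2 := Nat.Prime.factorization_pos_of_dvd Nat.prime_two hN'0 h2N'
    rw [h] at hpos
    exact h2N (Nat.dvd_of_factorization_pos (Nat.pos_iff_ne_zero.mp hpos))

/-! ## §2 The pair `(f_W, f_A)`: conductor, `f_A = (f_W)_χ`, Birch's lemma with the period identity -/

section Pair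

variable [W.IsGloballyMinimal] {d : ℤ} {A : WeierstrassCurve ℚ} [A.IsElliptic]

omit [W.IsGloballyMinimal] [A.IsElliptic] in
/-- **`N_W ∣ N_A`, `d² ∣ N_A`, `2 ∤ N_W ⇒ 2 ∤ N_A`** for a model `A` of `W^{(d)}` ADDITIVE at the places over `d` with `ord_ℓ N_W ≤ ord_ℓ N_A` there
(§1 + `conductorNorm_smul`); no restriction on the residue characteristics. [cite: SilvermanAEC2009, App. C §16] [cite: AtkinLehner1970, §6] -/
theorem conductorNorm_twist_dvd_addv_le (hd4 : d % 4 = 1) (hsq : Squarefree d)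
    (hadd : ∀ v : HeightOneSpectrum (𝓞 ℚ), ((primesEquiv v : ℕ) : ℤ) ∣ d →
      (W.conductorNorm ℤ).factorization (primesEquiv v : ℕ) ≤ (A.conductorNorm ℤ).factorization (primesEquiv v : ℕ) ∧
        A.HasAdditiveReductionAt v)
    {C : VariableChange ℚ} (hA : C • W.quadraticTwist (d : ℚ) = A) :
    W.conductorNorm ℤ ∣ A.conductorNorm ℤ ∧ d.natAbs ^ 2 ∣ A.conductorNorm ℤ ∧
      (¬ 2 ∣ W.conductorNorm ℤ → ¬ 2 ∣ A.conductorNorm ℤ) := by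
  have hd0 : d ≠ 0 := by omega
  have hdq : (d : ℚ) ≠ 0 := by exact_mod_cast hd0
  haveI := W.isElliptic_quadraticTwist hdq
  have hNA : A.conductorNorm ℤ = (W.quadraticTwist (d : ℚ)).conductorNorm ℤ := by
    rw [← hA]; exact WeierstrassCurve.conductorNorm_smul ℤ _ C
  rw [hNA]
  refine conductorNorm_dvd_and_sq_dvd_conductorNorm_quadraticTwist_of_addv_le W hd4 hsq fun v hvd ↦ ?_
  -- move to the `𝓞 ℚ`-place over the same prime
  obtain ⟨p, rfl⟩ := (primesEquiv (R := ℤ)).symm.surjective v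
  obtain ⟨w, hw⟩ : ∃ w : HeightOneSpectrum (𝓞 ℚ), primesEquiv w = p :=
    ⟨(primesEquiv (R := 𝓞 ℚ)).symm p, Equiv.apply_symm_apply _ _⟩
  subst hw
  have hgen : (natGenerator ((primesEquiv (R := ℤ)).symm (primesEquiv w)) : ℕ) = (primesEquiv w : ℕ) :=
    congrArg (fun q : Nat.Primes ↦ (q : ℕ)) ((primesEquiv (R := ℤ)).apply_symm_apply _)
  have hww : (primesEquiv (R := 𝓞 ℚ)).symm (primesEquiv w) = w := Equiv.symm_apply_apply _ w
  rw [hgen] at hvd ⊢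
  obtain ⟨hle, haddA⟩ := hadd w hvd
  rw [hNA] at hle
  refine ⟨hle, ?_⟩
  have h := (W.quadraticTwist (d : ℚ)).hasAdditiveReductionAt_int_iff_ringOfIntegers (primesEquiv w)
  rw [hww] at h
  exact h.mpr (hasAdditiveReductionAt_quadraticTwist_of_model W hd0 hA haddA)

omit [A.IsElliptic] in
/-- **`aₙ(A) = χ_d(n)·aₙ(W)`** for a model `A` of `W^{(d)}` additive at the places over `d` (the lead's §1, model form; only additivity is used).
[cite: SilvermanAEC2009, X.2 and Exercise 10.16] -/
theorem LFunction_twist_apply_addv' (hd4 : d % 4 = 1)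
    (hadd : ∀ v : HeightOneSpectrum (𝓞 ℚ), ((primesEquiv v : ℕ) : ℤ) ∣ d → A.HasAdditiveReductionAt v)
    {C : VariableChange ℚ} (hA : C • W.quadraticTwist (d : ℚ) = A) (n : ℕ) :
    A.LFunction n = J((n : ℤ) | d.natAbs) * W.LFunction n := by
  have hd0 : d ≠ 0 := by omega
  have hdq : (d : ℚ) ≠ 0 := by exact_mod_cast hd0
  haveI := W.isElliptic_quadraticTwist hdq
  rw [← hA, LFunction_smul]
  exact LFunction_quadraticTwist_apply_of_addv W hd4 (fun v hv ↦ hasAdditiveReductionAt_quadraticTwist_of_model W hd0 hA (hadd v hv)) n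

variable [NeZero (W.conductorNorm ℤ)] [NeZero (A.conductorNorm ℤ)] [NeZero d.natAbs]
  {fW : CuspForm (Gamma0 (W.conductorNorm ℤ)) 2} {fA : CuspForm (Gamma0 (A.conductorNorm ℤ)) 2}

omit [A.IsElliptic] in
/-- **`f_A = (f_W)_χ` at level `N_A`** (same `q`-expansions), `A` additive at the places over `d`. [cite: Shimura1971, Prop. 3.64] -/
theorem isNewformOf_twist_eq_charTwist_addv_le (hd4 : d % 4 = 1)
    (hadd : ∀ v : HeightOneSpectrum (𝓞 ℚ), ((primesEquiv v : ℕ) : ℤ) ∣ d →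
      (W.conductorNorm ℤ).factorization (primesEquiv v : ℕ) ≤ (A.conductorNorm ℤ).factorization (primesEquiv v : ℕ) ∧
        A.HasAdditiveReductionAt v)
    {C : VariableChange ℚ} (hA : C • W.quadraticTwist (d : ℚ) = A)
    (hfW : IsNewformOf W fW) (hfA : IsNewformOf A fA)
    {χ : MulChar (ZMod d.natAbs) ℤ} (hχ : ∀ a : ZMod d.natAbs, χ a = J((a.val : ℤ) | d.natAbs))
    (hq : (χ.ringHomComp (Int.castRingHom ℂ)).IsQuadratic)
    (hprim : DirichletCharacter.IsPrimitive (χ.ringHomComp (Int.castRingHom ℂ)))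
    (hN : W.conductorNorm ℤ ∣ A.conductorNorm ℤ) (hm : d.natAbs ^ 2 ∣ A.conductorNorm ℤ) :
    fA = charTwist (A.conductorNorm ℤ) hN hm hq fW := by
  refine eq_of_forall_cuspCoeff_eq_gamma0 fun n ↦ ?_
  rw [cuspCoeff_charTwist (A.conductorNorm ℤ) hN hm hq hprim fW n, hfA.2 n, hfW.2 n,
    LFunction_twist_apply_addv' W hd4 (fun v hv ↦ (hadd v hv).2) hA n, Int.cast_mul, MulChar.ringHomComp_apply, mulChar_jacobi_apply_natCast hχ,
    eq_intCast]

omit [A.IsElliptic] in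
/-- **Birch's lemma for `(f_W, f_A)` WITH the period constant** (`A` a model of `W^{(d)}`, `d > 0`, additive at the places over `d`):
`[x]⁺_{f_A} = c · Σ_b χ_d(b) [x + b/d]⁺_{f_W}` and `c²·d·(Ω⁺_{f_A})² = (Ω⁺_{f_W})²`. [cite: MazurTateTeitelbaum1986Invent, §I.8] [cite: Shimura1971, Prop. 3.64] -/
theorem exists_ratPlusSymbol_twist_eq_sum_and_sq_addv_le (hd : 0 < d) (hd4 : d % 4 = 1) (hsq : Squarefree d)
    (hadd : ∀ v : HeightOneSpectrum (𝓞 ℚ), ((primesEquiv v : ℕ) : ℤ) ∣ d →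
      (W.conductorNorm ℤ).factorization (primesEquiv v : ℕ) ≤ (A.conductorNorm ℤ).factorization (primesEquiv v : ℕ) ∧
        A.HasAdditiveReductionAt v)
    {C : VariableChange ℚ} (hA : C • W.quadraticTwist (d : ℚ) = A) (hfW : IsNewformOf W fW) (hfA : IsNewformOf A fA)
    {χ : MulChar (ZMod d.natAbs) ℤ} (hχ : ∀ a : ZMod d.natAbs, χ a = J((a.val : ℤ) | d.natAbs)) :
    ∃ c : ℚ, (∀ x : ℚ, ratPlusSymbol fA x =
        c * ∑ b : ZMod d.natAbs, (χ.ringHomComp (Int.castRingHom ℚ)) b * ratPlusSymbol fW (x + (b.val : ℚ) / d.natAbs)) ∧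
      ((∃ x : ℚ, ratPlusSymbol fA x ≠ 0) → (c : ℝ) ^ 2 * (d : ℝ) * plusPeriod fA ^ 2 = plusPeriod fW ^ 2) := by
  have hmd : (d.natAbs : ℤ) = d := Int.natAbs_of_nonneg hd.le
  have hodd : Odd d.natAbs := Int.natAbs_odd.mpr (Int.odd_iff.mpr (by omega))
  have hsq' : Squarefree d.natAbs := Int.squarefree_natAbs.mpr hsq
  have hm4 : d.natAbs % 4 = 1 := by omega
  obtain ⟨hq, hprim⟩ := mulChar_jacobi_complex_isQuadratic_isPrimitive hχ hodd hsq'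
  have heven : DirichletCharacter.Even (χ.ringHomComp (Int.castRingHom ℂ)) := by
    show (χ.ringHomComp (Int.castRingHom ℂ)) (-1) = 1
    rw [MulChar.ringHomComp_apply, mulChar_jacobi_apply_neg_one hχ hm4, map_one]
  have hg2 := gaussSum_jacobi_sq_eq hd hd4 hsq hχ
  obtain ⟨hN, hm, -⟩ := conductorNorm_twist_dvd_addv_le W hd4 hsq hadd hA
  have hFA := isNewformOf_twist_eq_charTwist_addv_le W hd4 hadd hA hfW hfA hχ hq hprim hN hm
  subst hFA
  obtain ⟨c, hc, hper⟩ := exists_rat_forall_ratPlusSymbol_charTwist_eq (A.conductorNorm ℤ) hN hm hq heven hprim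
    hfW.1 hfW.coeffField_eq_bot hfA.1 hfA.coeffField_eq_bot (fun u ↦ J((u.val : ℤ) | d.natAbs))
    (fun u ↦ by rw [MulChar.ringHomComp_apply, hχ, eq_intCast])
  have hsum : ∀ x : ℚ, ∑ b : ZMod d.natAbs, (χ.ringHomComp (Int.castRingHom ℚ)) b *
      ratPlusSymbol fW (x + (b.val : ℚ) / d.natAbs) =
      ∑ u : ZMod d.natAbs, (J((u.val : ℤ) | d.natAbs) : ℚ) * ratPlusSymbol fW (x + twistShift u) := by
    intro x
    refine Finset.sum_congr rfl fun b _ ↦ ?_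
    rw [MulChar.ringHomComp_apply, hχ, eq_intCast]
    rfl
  refine ⟨c, fun x ↦ by rw [hc x, hsum x], fun ⟨x, hx⟩ ↦ ?_⟩
  have hS : ∃ r : ℚ, ∑ u : ZMod d.natAbs, (J((u.val : ℤ) | d.natAbs) : ℚ) * ratPlusSymbol fW (r + twistShift u) ≠ 0 := by
    refine ⟨x, fun h0 ↦ hx ?_⟩
    rw [hc x, h0, mul_zero]
  have hP := hper hS
  have hsqP := congrArg (fun z : ℂ ↦ z ^ 2) hP
  rw [mul_pow, mul_pow, hg2] at hsqP
  have hdZ : ((d.natAbs : ℤ) : ℂ) = (d : ℂ) := congrArg (Int.cast : ℤ → ℂ) hmd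
  have hdC : ((d.natAbs : ℕ) : ℂ) = (d : ℂ) := by rw [← hdZ, Int.cast_natCast]
  rw [hdC] at hsqP
  apply Complex.ofReal_injective
  push_cast
  linear_combination hsqP

/-! ## §3 The unit root of the twist and the transform identity -/

omit [NeZero (W.conductorNorm ℤ)] [NeZero (A.conductorNorm ℤ)] [NeZero d.natAbs] in
/-- **`A` is good ORDINARY at `2` with unit root `α_A = (2 / |d|)·α_W`** (`d` odd). [cite: MazurTateTeitelbaum1986Invent, §I.11 (allowable root)] -/
theorem isOrdinaryAt_twist_and_unitRoot_eq_addv_le [A.IsGloballyMinimal] (hd4 : d % 4 = 1)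
    (hadd : ∀ v : HeightOneSpectrum (𝓞 ℚ), ((primesEquiv v : ℕ) : ℤ) ∣ d →
      (W.conductorNorm ℤ).factorization (primesEquiv v : ℕ) ≤ (A.conductorNorm ℤ).factorization (primesEquiv v : ℕ) ∧
        A.HasAdditiveReductionAt v)
    {C : VariableChange ℚ} (hA : C • W.quadraticTwist (d : ℚ) = A) (hord : IsOrdinaryAt W 2) :
    IsOrdinaryAt A 2 ∧ unitRoot A 2 = (J((2 : ℤ) | d.natAbs) : ℤ_[2]) * unitRoot W 2 := by
  have hd0 : d ≠ 0 := by omega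
  have hdq : (d : ℚ) ≠ 0 := by exact_mod_cast hd0
  have h2d : ¬ ((2 : ℕ) : ℤ) ∣ d := by intro h; omega
  haveI := W.isElliptic_quadraticTwist hdq
  -- `A` is good at `2` (`f_2(A) = f_2(W) = 0`) with `a_2(A) = χ(2) a_2(W)`
  have hpN : ¬ 2 ∣ W.conductorNorm ℤ := fun h ↦ (W.dvd_conductorNorm_iff_not_hasGoodReductionAtPrime 2).mp h hord.1
  set v2 : HeightOneSpectrum ℤ := (primesEquiv (R := ℤ)).symm ⟨2, Nat.prime_two⟩ with hv2
  have hgen2 : natGenerator v2 = 2 :=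
    congrArg (fun q : Nat.Primes ↦ (q : ℕ)) ((primesEquiv (R := ℤ)).apply_symm_apply ⟨2, Nat.prime_two⟩)
  have hfac := W.factorization_conductorNorm_quadraticTwist_eq_of_not_dvd hd4 v2 (by rw [hgen2]; exact h2d)
  rw [hgen2] at hfac
  have hNA : A.conductorNorm ℤ = (W.quadraticTwist (d : ℚ)).conductorNorm ℤ := by
    rw [← hA]; exact WeierstrassCurve.conductorNorm_smul ℤ _ C
  have hpNA : ¬ 2 ∣ A.conductorNorm ℤ := by
    intro h
    rw [hNA] at h
    have hpos : 0 < ((W.quadraticTwist (d : ℚ)).conductorNorm ℤ).factorization 2 :=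
      Nat.Prime.factorization_pos_of_dvd Nat.prime_two ((W.quadraticTwist (d : ℚ)).conductorNorm_pos_holds).ne' h
    rw [hfac] at hpos
    exact hpN (Nat.dvd_of_factorization_pos (Nat.pos_iff_ne_zero.mp hpos))
  have hgoodA : A.HasGoodReductionAtPrime 2 := by
    by_contra h
    exact hpNA ((A.dvd_conductorNorm_iff_not_hasGoodReductionAtPrime 2).mpr h)
  have haA : A.frobeniusTrace 2 = J((2 : ℤ) | d.natAbs) * W.frobeniusTrace 2 := by
    have h := LFunction_twist_apply_addv' W hd4 (fun v hv ↦ (hadd v hv).2) hA 2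
    rwa [LFunction_apply_prime_eq_frobeniusTrace A 2 hgoodA, LFunction_apply_prime_eq_frobeniusTrace W 2 hord.1] at h
  set s : ℤ := J((2 : ℤ) | d.natAbs) with hs
  have hpm : ¬ 2 ∣ d.natAbs := fun h ↦ h2d (Int.natCast_dvd.mpr h)
  have hs2 : s ^ 2 = 1 :=
    jacobiSym.sq_one (by
      rw [show (2 : ℤ) = ((2 : ℕ) : ℤ) by rfl, Int.gcd_natCast_natCast]
      exact (Nat.Prime.coprime_iff_not_dvd Nat.prime_two).mpr hpm)
  have hordA : IsOrdinaryAt A 2 := by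
    refine ⟨hgoodA, fun h ↦ hord.2 ?_⟩
    rw [haA] at h
    have h' := h.mul_left s
    rwa [← mul_assoc, ← sq, hs2, one_mul] at h'
  refine ⟨hordA, ?_⟩
  have hEU := existsUnique_unitRoot A 2 hordA
  have hspecA := unitRoot_spec_holds A 2 hordA
  have hspecW := unitRoot_spec_holds W 2 hord
  have hs2' : (s : ℤ_[2]) ^ 2 = 1 := by exact_mod_cast hs2
  have hβ : ((s : ℤ_[2]) * unitRoot W 2) ^ 2 - (A.frobeniusTrace 2 : ℤ_[2]) * ((s : ℤ_[2]) * unitRoot W 2) + 2 = 0 ∧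
      IsUnit ((s : ℤ_[2]) * unitRoot W 2) := by
    refine ⟨?_, ?_⟩
    · rw [haA]
      push_cast
      linear_combination (unitRoot W 2 ^ 2 - (W.frobeniusTrace 2 : ℤ_[2]) * unitRoot W 2) * hs2' + hspecW.1
    · exact (isUnit_iff_exists_inv.mpr ⟨(s : ℤ_[2]), by rw [← sq, hs2']⟩).mul hspecW.2
  have := hEU.unique hspecA hβ
  exact_mod_cast this

/-- **The transform identity `L₂(f_A, α_A) = C(c)·(1+T)^{−f_d}·L₂(f_W, d, α_W, χ_d)`, `c ≠ 0`, `c²·d·(Ω⁺_{f_A})² = (Ω⁺_{f_W})²**, `A` additive at the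
places over `d`, `W` good ordinary at `2`. [cite: MazurTateTeitelbaum1986Invent, §I.8 and §I.11–I.13] [cite: Matsuno2000, §2 (p. 84)] -/
theorem exists_padicLFunction_twist_eq_C_mul_padicLFunctionTame_and_sq_addv_le [A.IsGloballyMinimal] (hd : 0 < d) (hd4 : d % 4 = 1)
    (hsq : Squarefree d)
    (hadd : ∀ v : HeightOneSpectrum (𝓞 ℚ), ((primesEquiv v : ℕ) : ℤ) ∣ d →
      (W.conductorNorm ℤ).factorization (primesEquiv v : ℕ) ≤ (A.conductorNorm ℤ).factorization (primesEquiv v : ℕ) ∧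
        A.HasAdditiveReductionAt v)
    {C : VariableChange ℚ} (hA : C • W.quadraticTwist (d : ℚ) = A) (hfW : IsNewformOf W fW) (hfA : IsNewformOf A fA)
    (hord : IsOrdinaryAt W 2)
    {χ : MulChar (ZMod d.natAbs) ℤ} (hχ : ∀ a : ZMod d.natAbs, χ a = J((a.val : ℤ) | d.natAbs)) :
    ∃ c : ℚ, c ≠ 0 ∧ padicLFunction fA (unitRoot A 2 : ℚ_[2]) =
      PowerSeries.C (c : ℚ_[2]) * PowerSeries.binomialSeries ℚ_[2] (-frobeniusExponent 2 (d.natAbs : ℤ_[2])) *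
        padicLFunctionTame fW d.natAbs (unitRoot W 2 : ℚ_[2])
          ((χ.ringHomComp (Int.castRingHom ℚ)).ringHomComp (Rat.castHom ℚ_[2])) ∧
      (c : ℝ) ^ 2 * (d : ℝ) * plusPeriod fA ^ 2 = plusPeriod fW ^ 2 := by
  obtain ⟨c, hB, hper⟩ := exists_ratPlusSymbol_twist_eq_sum_and_sq_addv_le W hd hd4 hsq hadd hA hfW hfA hχ
  have hxA : ∃ x : ℚ, ratPlusSymbol fA x ≠ 0 := exists_ratPlusSymbol_ne_zero hfA.1 hfA.coeffField_eq_bot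
  have hc0 : c ≠ 0 := by
    rintro rfl
    obtain ⟨x, hx⟩ := hxA
    exact hx (by rw [hB x, zero_mul])
  have hd2 : ¬ ((2 : ℕ) : ℤ) ∣ d := by intro h; omega
  obtain ⟨hordA, hαA⟩ := isOrdinaryAt_twist_and_unitRoot_eq_addv_le W hd4 hadd hA hord
  obtain ⟨hαeq, hαu, -⟩ := unitRoot_coe_spec (W := W) hord
  have hpN : ¬ 2 ∣ W.conductorNorm ℤ := not_dvd_level_of_isNewformOf hfW hord.1
  have hpm : ¬ 2 ∣ d.natAbs := fun h ↦ hd2 (Int.natCast_dvd.mpr h)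
  have hmp : d.natAbs.Coprime 2 := Nat.coprime_comm.mp ((Nat.Prime.coprime_iff_not_dvd Nat.prime_two).mpr hpm)
  have hap : cuspCoeff fW 2 = ((W.frobeniusTrace 2 : ℤ) : ℂ) :=
    cuspCoeff_eq_frobeniusTrace_of_isNewformOf_holds hfW hord.1
  have hχp : (χ.ringHomComp (Int.castRingHom ℚ)) (2 : ZMod d.natAbs) ^ 2 = 1 := by
    have h := mulChar_jacobi_apply_natCast_sq hχ 2 hmp.symm
    rw [MulChar.ringHomComp_apply, ← map_pow]
    have h' : χ ((2 : ℕ) : ZMod d.natAbs) ^ 2 = 1 := h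
    rw [Nat.cast_ofNat] at h'
    rw [h', map_one]
  have key := padicLFunction_twist_eq_of_birch (p := 2) fW fA hfW.1 hfW.coeffField_eq_bot hpN hmp hap hαeq hαu
    (χ.ringHomComp (Int.castRingHom ℚ)) hχp hB
  have hαA' : (unitRoot A 2 : ℚ_[2]) =
      (((χ.ringHomComp (Int.castRingHom ℚ)) (2 : ZMod d.natAbs) : ℚ) : ℚ_[2]) * (unitRoot W 2 : ℚ_[2]) := by
    have h2 := mulChar_jacobi_apply_natCast hχ 2
    rw [Nat.cast_ofNat] at h2
    rw [hαA, MulChar.ringHomComp_apply, h2, eq_intCast]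
    push_cast
    rfl
  exact ⟨c, hc0, by rw [hαA']; exact key, hper hxA⟩

end Pair

end Summit.BirchSwinnertonDyer.BirchSwinnertonDyer.Theorems.AlignedTransportAtTwoWildTwistBirch

end
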